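import Literature.NumberTheory.Sieve.FGKMT2018ConditionalLaw
import Literature.NumberTheory.Sieve.FGKMT2018SigmaBounds
import HarnessLib

/-!
# Ford–Green–Konyagin–Maynard–Tao 2018 — §6, Lemma 6.3: concentration of `X_p(a⃗)` around `σ^r`
# over the uniform residue box (PROVED, explicit constants)

Topic `Literature/NumberTheory/Sieve`. Source: K. Ford, B. Green, S. Konyagin, J. Maynard, T. Tao,
*Long gaps between primes*, J. Amer. Math. Soc. 31 (2018) 65–105 = arXiv:1412.5029, §6 p. 18
[FordGreenKonyaginMaynardTao2018], Lemma 6.3: «With probability `1 − O(1/log^3 x)`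
[over `a⃗`], `𝒫(a⃗)` contains all but `O(#𝒫 / log^3 x)` of the primes `p ∈ 𝒫`» — proof (p. 18):
«performing the conditional expectation over `ñ_p` first … (6.16)
`E X_p(a⃗) = Σ_n P(ñ_p = n) P(n + h_i p ∈ S(a⃗) for i = 1, …, r) = (1 + O(1/log^{16} x)) σ^r`
[Lemma 6.1] … `E X_p(a⃗)² = Σ_{n₁,n₂} P(ñ^{(1)}_p = n₁) P(ñ^{(2)}_p = n₂)
P(n_l + h_i p ∈ S(a⃗) for i = 1..r; l = 1, 2)` … the quantity `#{n_l + h_i p}` is equal to `2r`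
with probability `1 − O(x^{-1/2-1/6+o(1)})` [by (6.7)], and is less than `2r` otherwise … by
Chebyshev's inequality».

This file PROVES the engine of Lemma 6.3 with explicit constants, for a general law `λ` on a finite
window `N` (nonnegative, `Σ λ = 1`, `λ ≤ Λ` — for `λ = P(ñ_p = ·)` one has `Λ = x^{-1/2-1/6+o(1)}` by
(6.7)), shift set `H` (`#H = r`), `p ≠ 0`, and prime moduli `S ∋ s ≥ s₀` (Lemma 6.1 regime):
with `T_n = {n + h p : h ∈ H}` (`FGKMT2018.shiftSet`) and
`X(a⃗) = Σ_n λ(n) 1_{T_n ⊆ S(a⃗)}` (`FGKMT2018.Xlaw`; `= X_p(a⃗)` for `λ = P(ñ_p = ·)`, `Xp_extendRes_eq`):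
* `boxExp_Xlaw`, `boxExp_Xlaw_ge/le` — (6.16): `σ^r e^{-2r² Σ 1/s²} ≤ E X ≤ σ^r/(1 − δ_r)`;
* `boxExp_Xlaw_sq`, `boxExp_Xlaw_sq_le` — `E X² ≤ σ^{2r}/(1 − δ_{2r}) + σ^r r² Λ/(1 − δ_{2r})`
  (pairs `n₁, n₂` with `T_{n₁} ∩ T_{n₂} ≠ ∅` number `≤ r²` for each `n₁`);
* `boxExp_Xlaw_var_le`, `lemma63_count` — Chebyshev: the number of `a⃗` in the box with
  `|X(a⃗) − σ^r| ≥ η σ^r` is at most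
  `((1/(1 − δ_{2r}) − 2 e^{-2r² Σ 1/s²} + 1) + r² Λ / ((1 − δ_{2r}) σ^r)) / η² · ∏ s`,
  where `δ_t = t³ log M / (s₀ log s₀)` and `M` bounds the diameter of the `T_{n₁} ∪ T_{n₂}`;
* `card_box_not_goodPrimes_le` — the same bound for `#{a⃗ : p ∉ 𝒫(a⃗)}` (`FGKMT2018.goodPrimes` with
  `X₀ = σ^r`), i.e. Lemma 6.3 per prime before averaging over `p ∈ 𝒫`.
Also `siftProb_anti`, `siftProb_le_one`, `sigmaProd_pos`, `sigma_eq_sigmaProd`.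
-/

noncomputable section

open Finset

namespace Literature.NumberTheory.Sieve

namespace FGKMT2018

/-! ### Monotonicity of the sieve probability; positivity of `σ` -/

/-- [cite: FordGreenKonyaginMaynardTao2018, Lemma 6.1 p. 17] -/
theorem hitRes_mono (s : ℕ) {T T' : Finset ℤ} (h : T ⊆ T') : hitRes s T ⊆ hitRes s T' :=
  Finset.image_subset_image h

/-- `T ⊆ T' ⟹ P(T' ⊆ S(a⃗)) ≤ P(T ⊆ S(a⃗))`. [cite: FordGreenKonyaginMaynardTao2018, Lemma 6.1 p. 17] -/
theorem siftProb_anti {S : Finset ℕ} (hS : ∀ s ∈ S, 0 < s) {T T' : Finset ℤ} (h : T ⊆ T') :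
    siftProb S T' ≤ siftProb S T := by
  rw [siftProb_eq_prod hS, siftProb_eq_prod hS]
  refine Finset.prod_le_prod (fun s hs => ?_) (fun s hs => ?_)
  · have hs0 : (0 : ℝ) < s := by exact_mod_cast hS s hs
    have hle : (#(hitRes s T') : ℝ) ≤ s := by exact_mod_cast card_hitRes_le_modulus (hS s hs) T'
    rw [sub_nonneg, div_le_one hs0]
    exact hle
  · have hs0 : (0 : ℝ) < s := by exact_mod_cast hS s hs
    have hle : (#(hitRes s T) : ℝ) ≤ #(hitRes s T') := by
      exact_mod_cast Finset.card_le_card (hitRes_mono s h)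
    have := div_le_div_of_nonneg_right hle hs0.le
    linarith

/-- [cite: FordGreenKonyaginMaynardTao2018, Lemma 6.1 p. 17] -/
theorem siftProb_empty {S : Finset ℕ} (hS : ∀ s ∈ S, 0 < s) : siftProb S ∅ = 1 := by
  rw [siftProb_eq_prod hS]
  simp [hitRes]

/-- [cite: FordGreenKonyaginMaynardTao2018, Lemma 6.1 p. 17] -/
theorem siftProb_le_one {S : Finset ℕ} (hS : ∀ s ∈ S, 0 < s) (T : Finset ℤ) : siftProb S T ≤ 1 := by
  have h := siftProb_anti hS (Finset.empty_subset T)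
  rwa [siftProb_empty hS] at h

/-- `σ > 0` for moduli `> 1`. [cite: FordGreenKonyaginMaynardTao2018, (6.8) p. 17] -/
theorem sigmaProd_pos {S : Finset ℕ} (hS : ∀ s ∈ S, 1 < s) : 0 < sigmaProd S := by
  unfold sigmaProd
  refine Finset.prod_pos fun s hs => ?_
  have hs1 : (1 : ℝ) < s := by exact_mod_cast hS s hs
  have : 1 / (s : ℝ) < 1 := by rw [div_lt_one (by linarith)]; exact hs1
  linarith

/-- The `σ` of (6.8) is the `sigmaProd` of the sieving primes `𝒮`.
[cite: FordGreenKonyaginMaynardTao2018, (6.8) p. 17] -/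
theorem sigma_eq_sigmaProd (x : ℕ) : sigma x = sigmaProd (primesS x) := rfl

/-! ### The shifted sets `T_n = {n + h p : h ∈ H}` -/

/-- `T_n := {n + h p : h ∈ H}`. [cite: FordGreenKonyaginMaynardTao2018, (6.10) p. 18] -/
def shiftSet (H : Finset ℤ) (p : ℕ) (n : ℤ) : Finset ℤ :=
  H.image fun h => n + h * (p : ℤ)

/-- [cite: FordGreenKonyaginMaynardTao2018, (6.10) p. 18] -/
theorem mem_shiftSet {H : Finset ℤ} {p : ℕ} {n m : ℤ} :
    m ∈ shiftSet H p n ↔ ∃ h ∈ H, n + h * (p : ℤ) = m :=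
  Finset.mem_image

/-- [cite: FordGreenKonyaginMaynardTao2018, (6.10) p. 18] -/
theorem shiftSet_injective {p : ℕ} (hp : p ≠ 0) (n : ℤ) :
    Function.Injective fun h : ℤ => n + h * (p : ℤ) := by
  intro h₁ h₂ heq
  have hp' : (p : ℤ) ≠ 0 := by exact_mod_cast hp
  have h' : h₁ * (p : ℤ) = h₂ * (p : ℤ) := by
    have := heq
    simp only at this
    linarith
  exact mul_right_cancel₀ hp' h'

/-- `#T_n = #H = r` («these are distinct for distinct `h`»). [cite: FordGreenKonyaginMaynardTao2018, §6 p. 18] -/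
theorem card_shiftSet (H : Finset ℤ) {p : ℕ} (hp : p ≠ 0) (n : ℤ) : #(shiftSet H p n) = #H :=
  Finset.card_image_of_injective _ (shiftSet_injective hp n)

/-- `#(T_{n₁} ∪ T_{n₂}) = 2r` when the two shifted sets are disjoint.
[cite: FordGreenKonyaginMaynardTao2018, Lemma 6.3 (proof) p. 18–19] -/
theorem card_shiftSet_union (H : Finset ℤ) {p : ℕ} (hp : p ≠ 0) {n n' : ℤ}
    (hd : Disjoint (shiftSet H p n) (shiftSet H p n')) :
    #(shiftSet H p n ∪ shiftSet H p n') = 2 * #H := by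
  rw [Finset.card_union_of_disjoint hd, card_shiftSet H hp, card_shiftSet H hp]
  ring

/-- If `T_{n₁}` meets `T_{n₂}` then `n₂ = n₁ + h p − h' p` for some `h, h' ∈ H`.
[cite: FordGreenKonyaginMaynardTao2018, Lemma 6.3 (proof) p. 19] -/
theorem mem_image_of_not_disjoint {H : Finset ℤ} {p : ℕ} {n n' : ℤ}
    (hd : ¬ Disjoint (shiftSet H p n) (shiftSet H p n')) :
    n' ∈ (H ×ˢ H).image fun hh : ℤ × ℤ => n + hh.1 * (p : ℤ) - hh.2 * (p : ℤ) := by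
  rw [Finset.not_disjoint_iff] at hd
  obtain ⟨m, hm, hm'⟩ := hd
  obtain ⟨h, hh, rfl⟩ := mem_shiftSet.1 hm
  obtain ⟨h', hh', heq⟩ := mem_shiftSet.1 hm'
  refine Finset.mem_image.2 ⟨(h, h'), Finset.mk_mem_product hh hh', ?_⟩
  simp only
  linarith

/-- For each `n₁`, at most `r²` values `n₂` have `T_{n₁} ∩ T_{n₂} ≠ ∅`.
[cite: FordGreenKonyaginMaynardTao2018, Lemma 6.3 (proof) p. 19] -/
theorem card_filter_not_disjoint_le (H : Finset ℤ) (p : ℕ) (n : ℤ) (N : Finset ℤ) :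
    #(N.filter fun n' => ¬ Disjoint (shiftSet H p n) (shiftSet H p n')) ≤ #H ^ 2 := by
  classical
  calc #(N.filter fun n' => ¬ Disjoint (shiftSet H p n) (shiftSet H p n'))
        ≤ #((H ×ˢ H).image fun hh : ℤ × ℤ => n + hh.1 * (p : ℤ) - hh.2 * (p : ℤ)) :=
          Finset.card_le_card fun n' hn' => mem_image_of_not_disjoint (Finset.mem_filter.1 hn').2
    _ ≤ #(H ×ˢ H) := Finset.card_image_le
    _ = #H ^ 2 := by rw [Finset.card_product, sq]

/-! ### `X(a⃗) = Σ_n λ(n) 1_{T_n ⊆ S(a⃗)}` and its moments over the box -/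

/-- `X(a⃗) := Σ_{n ∈ N} λ(n) · 1_{T_n ⊆ S(a⃗)}` in the box format (`a⃗ = extendRes S f`); for
`λ = P(ñ_p = ·)` this is `X_p(a⃗)` of (6.10) (`Xp_extendRes_eq`).
[cite: FordGreenKonyaginMaynardTao2018, (6.10) p. 18] -/
def Xlaw (S : Finset ℕ) (H : Finset ℤ) (p : ℕ) (lam : ℤ → ℝ) (N : Finset ℤ)
    (f : (s : ℕ) → s ∈ S → ℕ) : ℝ :=
  ∑ n ∈ N, lam n * siftInd S (shiftSet H p n) f

/-- `X_p(a⃗) = X(a⃗)` with `λ = P(ñ_p = ·)`. [cite: FordGreenKonyaginMaynardTao2018, (6.10) p. 18] -/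
theorem Xp_extendRes_eq {x : ℕ} (H : Finset ℤ) (w : ℕ → ℤ → ℝ) (N : Finset ℤ) (p : ℕ)
    (f : (s : ℕ) → s ∈ primesS x → ℕ) :
    Xp x (extendRes (primesS x) f) H w N p = Xlaw (primesS x) H p (lawTilde w N p) N f := by
  unfold Xp Xlaw
  refine Finset.sum_congr rfl fun n _ => ?_
  rw [Zp_extendRes, mul_comm]
  rfl

/-- [cite: FordGreenKonyaginMaynardTao2018, (6.10) p. 18] -/
theorem Xlaw_nonneg (S : Finset ℕ) (H : Finset ℤ) (p : ℕ) {lam : ℤ → ℝ} (hlam : ∀ n, 0 ≤ lam n)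
    (N : Finset ℤ) (f : (s : ℕ) → s ∈ S → ℕ) : 0 ≤ Xlaw S H p lam N f :=
  Finset.sum_nonneg fun n _ => mul_nonneg (hlam n) (siftInd_nonneg S _ f)

/-- **(6.16), exact form**: `E X = Σ_n λ(n) P(T_n ⊆ S(a⃗))`.
[cite: FordGreenKonyaginMaynardTao2018, (6.16) p. 18] -/
theorem boxExp_Xlaw (S : Finset ℕ) (H : Finset ℤ) (p : ℕ) (lam : ℤ → ℝ) (N : Finset ℤ) :
    boxExp S (Xlaw S H p lam N) = ∑ n ∈ N, lam n * siftProb S (shiftSet H p n) := by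
  unfold Xlaw
  rw [boxExp_sum]
  refine Finset.sum_congr rfl fun n _ => ?_
  rw [boxExp_const_mul, boxExp_siftInd]

/-- **(6.16), lower bound** (Lemma 6.1): `σ^r e^{-2r² Σ_s 1/s²} Σλ ≤ E X`.
[cite: FordGreenKonyaginMaynardTao2018, (6.16) p. 18] -/
theorem boxExp_Xlaw_ge {S : Finset ℕ} (hS : ∀ s ∈ S, 0 < s) {H : Finset ℤ} {p : ℕ} (hp : p ≠ 0)
    (h2r : ∀ s ∈ S, 2 * #H ≤ s) {lam : ℤ → ℝ} (hlam : ∀ n, 0 ≤ lam n) (N : Finset ℤ) :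
    sigmaProd S ^ #H * Real.exp (-(2 * (#H : ℝ) ^ 2 * ∑ s ∈ S, 1 / (s : ℝ) ^ 2)) *
        ∑ n ∈ N, lam n ≤ boxExp S (Xlaw S H p lam N) := by
  rw [boxExp_Xlaw, Finset.mul_sum]
  refine Finset.sum_le_sum fun n _ => ?_
  rw [mul_comm]
  refine mul_le_mul_of_nonneg_left ?_ (hlam n)
  have h := lemma61_lower hS (T := shiftSet H p n)
    (by intro s hs; rw [card_shiftSet H hp]; exact h2r s hs)
  rwa [card_shiftSet H hp] at h

/-- **(6.16), upper bound** (Lemma 6.1): `E X ≤ σ^r/(1 − δ_r) Σλ`, `δ_r = r³ log M/(s₀ log s₀)`,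
where `M` bounds all `|(n₁ + h₁ p) − (n₂ + h₂ p)|`, `nᵢ ∈ N`, `hᵢ ∈ H`.
[cite: FordGreenKonyaginMaynardTao2018, (6.16) p. 18] -/
theorem boxExp_Xlaw_le {S : Finset ℕ} (hS : ∀ s ∈ S, s.Prime) {s₀ : ℕ} (hs₀ : 2 ≤ s₀)
    (hSs₀ : ∀ s ∈ S, s₀ ≤ s) {H : Finset ℤ} {p : ℕ} (hp : p ≠ 0) {lam : ℤ → ℝ}
    (hlam : ∀ n, 0 ≤ lam n) {N : Finset ℤ} {M : ℝ} (hM1 : 1 ≤ M)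
    (hM : ∀ n ∈ N, ∀ n' ∈ N, ∀ h ∈ H, ∀ h' ∈ H,
      |((n + h * (p : ℤ) : ℤ) : ℝ) - ((n' + h' * (p : ℤ) : ℤ) : ℝ)| ≤ M)
    (hr : #H ≤ s₀) (hδ : (#H : ℝ) ^ 3 * Real.log M / (s₀ * Real.log s₀) < 1) :
    boxExp S (Xlaw S H p lam N) ≤
      sigmaProd S ^ #H / (1 - (#H : ℝ) ^ 3 * Real.log M / (s₀ * Real.log s₀)) * ∑ n ∈ N, lam n := by
  rw [boxExp_Xlaw, Finset.mul_sum]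
  refine Finset.sum_le_sum fun n hn => ?_
  rw [mul_comm]
  refine mul_le_mul_of_nonneg_right ?_ (hlam n)
  have hdiam : ∀ m ∈ shiftSet H p n, ∀ m' ∈ shiftSet H p n, (|m - m'| : ℝ) ≤ M := by
    intro m hm m' hm'
    obtain ⟨h, hh, rfl⟩ := mem_shiftSet.1 hm
    obtain ⟨h', hh', rfl⟩ := mem_shiftSet.1 hm'
    exact hM n hn n hn h hh h' hh'
  have h := lemma61_upper hS hs₀ hSs₀ hM1 hdiam (by rw [card_shiftSet H hp]; exact hr)
    (by rw [card_shiftSet H hp]; exact hδ)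
  rwa [card_shiftSet H hp] at h

/-- `X² = Σ_{n₁,n₂} λ(n₁) λ(n₂) 1_{T_{n₁} ∪ T_{n₂} ⊆ S(a⃗)}`.
[cite: FordGreenKonyaginMaynardTao2018, Lemma 6.3 (proof) p. 18] -/
theorem Xlaw_sq (S : Finset ℕ) (H : Finset ℤ) (p : ℕ) (lam : ℤ → ℝ) (N : Finset ℤ)
    (f : (s : ℕ) → s ∈ S → ℕ) :
    Xlaw S H p lam N f ^ 2 =
      ∑ n ∈ N, ∑ n' ∈ N, lam n * lam n' * siftInd S (shiftSet H p n ∪ shiftSet H p n') f := by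
  unfold Xlaw
  rw [sq, Finset.sum_mul_sum]
  refine Finset.sum_congr rfl fun n _ => Finset.sum_congr rfl fun n' _ => ?_
  rw [← siftInd_mul]
  ring

/-- `E X² = Σ_{n₁,n₂} λ(n₁) λ(n₂) P(T_{n₁} ∪ T_{n₂} ⊆ S(a⃗))`.
[cite: FordGreenKonyaginMaynardTao2018, Lemma 6.3 (proof) p. 18] -/
theorem boxExp_Xlaw_sq (S : Finset ℕ) (H : Finset ℤ) (p : ℕ) (lam : ℤ → ℝ) (N : Finset ℤ) :
    boxExp S (fun f => Xlaw S H p lam N f ^ 2) =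
      ∑ n ∈ N, ∑ n' ∈ N, lam n * lam n' * siftProb S (shiftSet H p n ∪ shiftSet H p n') := by
  simp_rw [Xlaw_sq]
  rw [boxExp_sum]
  refine Finset.sum_congr rfl fun n _ => ?_
  rw [boxExp_sum]
  refine Finset.sum_congr rfl fun n' _ => ?_
  rw [boxExp_const_mul, boxExp_siftInd]

/-- **Second moment**: `E X² ≤ (σ^{2r}/(1 − δ_{2r}) Σλ + σ^r r² Λ/(1 − δ_{2r})) Σλ` for `λ ≤ Λ`
(disjoint pairs via Lemma 6.1 with `2r` points; the `≤ r²` non-disjoint partners of each `n₁` via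
`P(T_{n₁} ∪ T_{n₂} ⊆ S) ≤ P(T_{n₁} ⊆ S)`).
[cite: FordGreenKonyaginMaynardTao2018, Lemma 6.3 (proof) pp. 18–19] -/
theorem boxExp_Xlaw_sq_le {S : Finset ℕ} (hS : ∀ s ∈ S, s.Prime) {s₀ : ℕ} (hs₀ : 2 ≤ s₀)
    (hSs₀ : ∀ s ∈ S, s₀ ≤ s) {H : Finset ℤ} {p : ℕ} (hp : p ≠ 0) {lam : ℤ → ℝ}
    (hlam : ∀ n, 0 ≤ lam n) {Λ : ℝ} (hΛ : ∀ n, lam n ≤ Λ) {N : Finset ℤ} {M : ℝ} (hM1 : 1 ≤ M)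
    (hM : ∀ n ∈ N, ∀ n' ∈ N, ∀ h ∈ H, ∀ h' ∈ H,
      |((n + h * (p : ℤ) : ℤ) : ℝ) - ((n' + h' * (p : ℤ) : ℤ) : ℝ)| ≤ M)
    (h2r : 2 * #H ≤ s₀)
    (hδ₂ : (2 * (#H : ℝ)) ^ 3 * Real.log M / (s₀ * Real.log s₀) < 1) :
    boxExp S (fun f => Xlaw S H p lam N f ^ 2) ≤
      (sigmaProd S ^ (2 * #H) / (1 - (2 * (#H : ℝ)) ^ 3 * Real.log M / (s₀ * Real.log s₀)) *
          ∑ n ∈ N, lam n +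
        sigmaProd S ^ #H / (1 - (2 * (#H : ℝ)) ^ 3 * Real.log M / (s₀ * Real.log s₀)) *
          ((#H : ℝ) ^ 2 * Λ)) * ∑ n ∈ N, lam n := by
  classical
  have hS0 : ∀ s ∈ S, 0 < s := fun s hs => (hS s hs).pos
  set δ₂ : ℝ := (2 * (#H : ℝ)) ^ 3 * Real.log M / (s₀ * Real.log s₀) with hδ₂def
  set δ₁ : ℝ := (#H : ℝ) ^ 3 * Real.log M / (s₀ * Real.log s₀) with hδ₁def
  set σ : ℝ := sigmaProd S with hσdef
  have hσ0 : 0 ≤ σ := sigmaProd_nonneg hS0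
  have hs₀pos : (0 : ℝ) < s₀ := by exact_mod_cast (show 0 < s₀ by omega)
  have hlogs₀ : 0 < Real.log s₀ := Real.log_pos (by exact_mod_cast (show 1 < s₀ by omega))
  have hden : 0 < (s₀ : ℝ) * Real.log s₀ := mul_pos hs₀pos hlogs₀
  have hlogM : 0 ≤ Real.log M := Real.log_nonneg hM1
  have hδ₁₂ : δ₁ ≤ δ₂ := by
    rw [hδ₁def, hδ₂def]
    refine div_le_div_of_nonneg_right (mul_le_mul_of_nonneg_right ?_ hlogM) hden.le
    exact pow_le_pow_left₀ (Nat.cast_nonneg _) (by linarith [(Nat.cast_nonneg (#H) : (0 : ℝ) ≤ #H)]) 3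
  have hδ₁1 : δ₁ < 1 := lt_of_le_of_lt hδ₁₂ hδ₂
  have h1δ₂ : 0 < 1 - δ₂ := by linarith
  have hΛ0 : 0 ≤ Λ := (hlam 0).trans (hΛ 0)
  have hsum0 : 0 ≤ ∑ n ∈ N, lam n := Finset.sum_nonneg fun n _ => hlam n
  -- the two constants
  set A : ℝ := σ ^ (2 * #H) / (1 - δ₂) with hAdef
  set B : ℝ := σ ^ #H / (1 - δ₂) * ((#H : ℝ) ^ 2 * Λ) with hBdef
  have hA0 : 0 ≤ A := div_nonneg (pow_nonneg hσ0 _) h1δ₂.le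
  have hA10 : 0 ≤ σ ^ #H / (1 - δ₂) := div_nonneg (pow_nonneg hσ0 _) h1δ₂.le
  rw [boxExp_Xlaw_sq, show (A * ∑ n ∈ N, lam n + B) * ∑ n ∈ N, lam n =
    ∑ n ∈ N, (A * ∑ n' ∈ N, lam n' + B) * lam n from Finset.mul_sum N (fun n => lam n) _]
  refine Finset.sum_le_sum fun n hn => ?_
  -- per n₁: Σ_{n₂} λ λ' P(T ∪ T' ⊆ S) ≤ λ(n₁) (A Σλ + B)
  have hdisj_bound : ∀ n' ∈ N, Disjoint (shiftSet H p n) (shiftSet H p n') →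
      siftProb S (shiftSet H p n ∪ shiftSet H p n') ≤ A := by
    intro n' hn' hd
    have hdiam : ∀ m ∈ shiftSet H p n ∪ shiftSet H p n', ∀ m' ∈ shiftSet H p n ∪ shiftSet H p n',
        (|m - m'| : ℝ) ≤ M := by
      intro m hm m' hm'
      rw [Finset.mem_union] at hm hm'
      rcases hm with hm | hm <;> rcases hm' with hm' | hm' <;>
        obtain ⟨h, hh, rfl⟩ := mem_shiftSet.1 hm <;>
        obtain ⟨h', hh', rfl⟩ := mem_shiftSet.1 hm'
      · exact hM n hn n hn h hh h' hh'
      · exact hM n hn n' hn' h hh h' hh'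
      · exact hM n' hn' n hn h hh h' hh'
      · exact hM n' hn' n' hn' h hh h' hh'
    have hcard := card_shiftSet_union H hp hd
    have h := lemma61_upper hS hs₀ hSs₀ hM1 hdiam (by rw [hcard]; exact h2r)
      (by rw [hcard]; push_cast; exact hδ₂)
    rw [hcard] at h
    push_cast at h
    exact h
  have hmeet_bound : ∀ n' ∈ N, siftProb S (shiftSet H p n ∪ shiftSet H p n') ≤ σ ^ #H / (1 - δ₂) := by
    intro n' _
    refine (siftProb_anti hS0 Finset.subset_union_left).trans ?_
    have hdiam : ∀ m ∈ shiftSet H p n, ∀ m' ∈ shiftSet H p n, (|m - m'| : ℝ) ≤ M := by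
      intro m hm m' hm'
      obtain ⟨h, hh, rfl⟩ := mem_shiftSet.1 hm
      obtain ⟨h', hh', rfl⟩ := mem_shiftSet.1 hm'
      exact hM n hn n hn h hh h' hh'
    have hr : #H ≤ s₀ := by omega
    have h := lemma61_upper hS hs₀ hSs₀ hM1 hdiam (by rw [card_shiftSet H hp]; exact hr)
      (by rw [card_shiftSet H hp]; exact hδ₁1)
    rw [card_shiftSet H hp] at h
    refine h.trans ?_
    exact div_le_div_of_nonneg_left (pow_nonneg hσ0 _) h1δ₂ (by linarith)
  -- split the inner sum
  have hinner : ∑ n' ∈ N, lam n * lam n' * siftProb S (shiftSet H p n ∪ shiftSet H p n') ≤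
      lam n * (A * ∑ n' ∈ N, lam n' + B) := by
    have hrw : ∑ n' ∈ N, lam n * lam n' * siftProb S (shiftSet H p n ∪ shiftSet H p n') =
        lam n * ∑ n' ∈ N, lam n' * siftProb S (shiftSet H p n ∪ shiftSet H p n') := by
      rw [Finset.mul_sum]
      refine Finset.sum_congr rfl fun n' _ => ?_
      ring
    rw [hrw]
    refine mul_le_mul_of_nonneg_left ?_ (hlam n)
    rw [← Finset.sum_filter_add_sum_filter_not N
      (fun n' => Disjoint (shiftSet H p n) (shiftSet H p n'))]
    refine add_le_add ?_ ?_
    · calc ∑ n' ∈ N.filter (fun n' => Disjoint (shiftSet H p n) (shiftSet H p n')),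
              lam n' * siftProb S (shiftSet H p n ∪ shiftSet H p n')
            ≤ ∑ n' ∈ N.filter (fun n' => Disjoint (shiftSet H p n) (shiftSet H p n')),
              lam n' * A := by
              refine Finset.sum_le_sum fun n' hn' => ?_
              rw [Finset.mem_filter] at hn'
              exact mul_le_mul_of_nonneg_left (hdisj_bound n' hn'.1 hn'.2) (hlam n')
        _ = A * ∑ n' ∈ N.filter (fun n' => Disjoint (shiftSet H p n) (shiftSet H p n')),
              lam n' := by rw [Finset.mul_sum]; exact Finset.sum_congr rfl fun _ _ => mul_comm _ _
        _ ≤ A * ∑ n' ∈ N, lam n' := by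
              refine mul_le_mul_of_nonneg_left ?_ hA0
              exact Finset.sum_le_sum_of_subset_of_nonneg (Finset.filter_subset _ _)
                fun n' _ _ => hlam n'
    · calc ∑ n' ∈ N.filter (fun n' => ¬ Disjoint (shiftSet H p n) (shiftSet H p n')),
              lam n' * siftProb S (shiftSet H p n ∪ shiftSet H p n')
            ≤ ∑ n' ∈ N.filter (fun n' => ¬ Disjoint (shiftSet H p n) (shiftSet H p n')),
              Λ * (σ ^ #H / (1 - δ₂)) := by
              refine Finset.sum_le_sum fun n' hn' => ?_
              rw [Finset.mem_filter] at hn'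
              exact mul_le_mul (hΛ n') (hmeet_bound n' hn'.1) (siftProb_nonneg S _) hΛ0
        _ = #(N.filter (fun n' => ¬ Disjoint (shiftSet H p n) (shiftSet H p n'))) *
              (Λ * (σ ^ #H / (1 - δ₂))) := by rw [Finset.sum_const, nsmul_eq_mul]
        _ ≤ (#H : ℝ) ^ 2 * (Λ * (σ ^ #H / (1 - δ₂))) := by
              refine mul_le_mul_of_nonneg_right ?_ (mul_nonneg hΛ0 hA10)
              exact_mod_cast card_filter_not_disjoint_le H p n N
        _ = B := by rw [hBdef]; ring
  calc ∑ n' ∈ N, lam n * lam n' * siftProb S (shiftSet H p n ∪ shiftSet H p n')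
        ≤ lam n * (A * ∑ n' ∈ N, lam n' + B) := hinner
    _ = (A * ∑ n' ∈ N, lam n' + B) * lam n := mul_comm _ _

/-- **Variance**: for a law (`Σλ = 1`),
`E (X − σ^r)² ≤ σ^{2r} (1/(1 − δ_{2r}) − 2 e^{-2r² Σ 1/s²} + 1) + σ^r r² Λ/(1 − δ_{2r})`.
[cite: FordGreenKonyaginMaynardTao2018, Lemma 6.3 (proof) pp. 18–19] -/
theorem boxExp_Xlaw_var_le {S : Finset ℕ} (hS : ∀ s ∈ S, s.Prime) {s₀ : ℕ} (hs₀ : 2 ≤ s₀)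
    (hSs₀ : ∀ s ∈ S, s₀ ≤ s) {H : Finset ℤ} {p : ℕ} (hp : p ≠ 0) {lam : ℤ → ℝ}
    (hlam : ∀ n, 0 ≤ lam n) {Λ : ℝ} (hΛ : ∀ n, lam n ≤ Λ) {N : Finset ℤ}
    (hsum : ∑ n ∈ N, lam n = 1) {M : ℝ} (hM1 : 1 ≤ M)
    (hM : ∀ n ∈ N, ∀ n' ∈ N, ∀ h ∈ H, ∀ h' ∈ H,
      |((n + h * (p : ℤ) : ℤ) : ℝ) - ((n' + h' * (p : ℤ) : ℤ) : ℝ)| ≤ M)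
    (h2r : 2 * #H ≤ s₀)
    (hδ₂ : (2 * (#H : ℝ)) ^ 3 * Real.log M / (s₀ * Real.log s₀) < 1) :
    boxExp S (fun f => (Xlaw S H p lam N f - sigmaProd S ^ #H) ^ 2) ≤
      sigmaProd S ^ (2 * #H) *
          (1 / (1 - (2 * (#H : ℝ)) ^ 3 * Real.log M / (s₀ * Real.log s₀)) -
            2 * Real.exp (-(2 * (#H : ℝ) ^ 2 * ∑ s ∈ S, 1 / (s : ℝ) ^ 2)) + 1) +
        sigmaProd S ^ #H / (1 - (2 * (#H : ℝ)) ^ 3 * Real.log M / (s₀ * Real.log s₀)) *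
          ((#H : ℝ) ^ 2 * Λ) := by
  have hS0 : ∀ s ∈ S, 0 < s := fun s hs => (hS s hs).pos
  set δ₂ : ℝ := (2 * (#H : ℝ)) ^ 3 * Real.log M / (s₀ * Real.log s₀) with hδ₂def
  set σ : ℝ := sigmaProd S with hσdef
  set L : ℝ := Real.exp (-(2 * (#H : ℝ) ^ 2 * ∑ s ∈ S, 1 / (s : ℝ) ^ 2)) with hLdef
  have hσ0 : 0 ≤ σ := sigmaProd_nonneg hS0
  -- E X² ≤ …, E X ≥ σ^r L
  have h2 := boxExp_Xlaw_sq_le hS hs₀ hSs₀ hp hlam hΛ hM1 hM h2r hδ₂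
  rw [hsum, mul_one, mul_one, ← hδ₂def, ← hσdef] at h2
  have h1 := boxExp_Xlaw_ge hS0 hp (fun s hs => le_trans h2r (hSs₀ s hs)) hlam N (H := H)
  rw [hsum, mul_one, ← hσdef, ← hLdef] at h1
  -- expand the square
  have hexp : ∀ f : (s : ℕ) → s ∈ S → ℕ, (Xlaw S H p lam N f - σ ^ #H) ^ 2 =
      (Xlaw S H p lam N f ^ 2 - 2 * σ ^ #H * Xlaw S H p lam N f) + (σ ^ #H) ^ 2 := fun f => by ring
  simp_rw [hexp]
  rw [boxExp_add, boxExp_sub, boxExp_const_mul, boxExp_const hS0]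
  have hm0 : 0 ≤ 2 * σ ^ #H := by positivity
  have h3 : 2 * σ ^ #H * (σ ^ #H * L) ≤ 2 * σ ^ #H * boxExp S (Xlaw S H p lam N) :=
    mul_le_mul_of_nonneg_left h1 hm0
  have hpow : σ ^ (2 * #H) = σ ^ #H * σ ^ #H := by rw [two_mul, pow_add]
  rw [hpow] at h2 ⊢
  have hkey : σ ^ #H * σ ^ #H * (1 / (1 - δ₂) - 2 * L + 1) =
      σ ^ #H * σ ^ #H / (1 - δ₂) - 2 * σ ^ #H * (σ ^ #H * L) + σ ^ #H * σ ^ #H := by ring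
  rw [hkey]
  have hsq : (σ ^ #H) ^ 2 = σ ^ #H * σ ^ #H := sq _
  rw [hsq]
  linarith [h2, h3]

/-- **Lemma 6.3 (engine), counting form.** For prime moduli `S ∋ s ≥ s₀ ≥ 2`, a law `λ` on `N`
(`λ ≥ 0`, `Σλ = 1`, `λ ≤ Λ`), `p ≠ 0`, `2r ≤ s₀`, `δ_{2r} < 1` and `η > 0`: the number of `a⃗`
in the residue box with `|X(a⃗) − σ^r| ≥ η σ^r` is at most
`((1/(1 − δ_{2r}) − 2 e^{-2r² Σ 1/s²} + 1) + r² Λ/((1 − δ_{2r}) σ^r)) / η² · ∏_{s ∈ S} s`.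
(In the paper's regime `s₀ = log^{20} x`, `r ≤ log^{1/5} x`, `M ≤ x²`, `Λ = x^{-0.6}`,
`σ^r = x^{-o(1)}`, `η = log^{-3} x` this is `O(log^{-12} x) ∏ s`.)
[cite: FordGreenKonyaginMaynardTao2018, Lemma 6.3 p. 18] -/
theorem lemma63_count {S : Finset ℕ} (hS : ∀ s ∈ S, s.Prime) {s₀ : ℕ} (hs₀ : 2 ≤ s₀)
    (hSs₀ : ∀ s ∈ S, s₀ ≤ s) {H : Finset ℤ} {p : ℕ} (hp : p ≠ 0) {lam : ℤ → ℝ}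
    (hlam : ∀ n, 0 ≤ lam n) {Λ : ℝ} (hΛ : ∀ n, lam n ≤ Λ) {N : Finset ℤ}
    (hsum : ∑ n ∈ N, lam n = 1) {M : ℝ} (hM1 : 1 ≤ M)
    (hM : ∀ n ∈ N, ∀ n' ∈ N, ∀ h ∈ H, ∀ h' ∈ H,
      |((n + h * (p : ℤ) : ℤ) : ℝ) - ((n' + h' * (p : ℤ) : ℤ) : ℝ)| ≤ M)
    (h2r : 2 * #H ≤ s₀)
    (hδ₂ : (2 * (#H : ℝ)) ^ 3 * Real.log M / (s₀ * Real.log s₀) < 1) {η : ℝ} (hη : 0 < η) :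
    (#((residueBox S).filter fun f =>
        η * sigmaProd S ^ #H ≤ |Xlaw S H p lam N f - sigmaProd S ^ #H|) : ℝ) ≤
      ((1 / (1 - (2 * (#H : ℝ)) ^ 3 * Real.log M / (s₀ * Real.log s₀)) -
            2 * Real.exp (-(2 * (#H : ℝ) ^ 2 * ∑ s ∈ S, 1 / (s : ℝ) ^ 2)) + 1) +
          (#H : ℝ) ^ 2 * Λ /
            ((1 - (2 * (#H : ℝ)) ^ 3 * Real.log M / (s₀ * Real.log s₀)) * sigmaProd S ^ #H)) /
        η ^ 2 * ∏ s ∈ S, (s : ℝ) := by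
  classical
  have hS0 : ∀ s ∈ S, 0 < s := fun s hs => (hS s hs).pos
  set δ₂ : ℝ := (2 * (#H : ℝ)) ^ 3 * Real.log M / (s₀ * Real.log s₀) with hδ₂def
  set σ : ℝ := sigmaProd S with hσdef
  set L : ℝ := Real.exp (-(2 * (#H : ℝ) ^ 2 * ∑ s ∈ S, 1 / (s : ℝ) ^ 2)) with hLdef
  have hσpos : 0 < σ := sigmaProd_pos fun s hs => (hS s hs).one_lt
  have hσr : 0 < σ ^ #H := pow_pos hσpos _
  have h1δ₂ : 0 < 1 - δ₂ := by linarith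
  have ht : 0 < (η * σ ^ #H) ^ 2 := by positivity
  -- pass to the square and apply the counting Markov inequality of the box
  have hsub : ((residueBox S).filter fun f => η * σ ^ #H ≤ |Xlaw S H p lam N f - σ ^ #H|) ⊆
      (residueBox S).filter fun f => (η * σ ^ #H) ^ 2 ≤ (Xlaw S H p lam N f - σ ^ #H) ^ 2 := by
    intro f hf
    rw [Finset.mem_filter] at hf ⊢
    refine ⟨hf.1, ?_⟩
    have h := pow_le_pow_left₀ (by positivity) hf.2 2
    rwa [sq_abs] at h
  have hvar := boxExp_Xlaw_var_le hS hs₀ hSs₀ hp hlam hΛ hsum hM1 hM h2r hδ₂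
  have hcount := card_box_filter_le hS0 (fun f => (Xlaw S H p lam N f - σ ^ #H) ^ 2)
    (fun f _ => sq_nonneg _) ht
  have hprod : 0 < ∏ s ∈ S, (s : ℝ) := prod_moduli_pos hS0
  calc (#((residueBox S).filter fun f => η * σ ^ #H ≤ |Xlaw S H p lam N f - σ ^ #H|) : ℝ)
        ≤ #((residueBox S).filter fun f => (η * σ ^ #H) ^ 2 ≤ (Xlaw S H p lam N f - σ ^ #H) ^ 2) := by
          exact_mod_cast Finset.card_le_card hsub
    _ ≤ boxExp S (fun f => (Xlaw S H p lam N f - σ ^ #H) ^ 2) / (η * σ ^ #H) ^ 2 *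
          ∏ s ∈ S, (s : ℝ) := hcount
    _ ≤ (σ ^ (2 * #H) * (1 / (1 - δ₂) - 2 * L + 1) + σ ^ #H / (1 - δ₂) * ((#H : ℝ) ^ 2 * Λ)) /
          (η * σ ^ #H) ^ 2 * ∏ s ∈ S, (s : ℝ) := by
          refine mul_le_mul_of_nonneg_right ?_ hprod.le
          exact div_le_div_of_nonneg_right hvar ht.le
    _ = ((1 / (1 - δ₂) - 2 * L + 1) + (#H : ℝ) ^ 2 * Λ / ((1 - δ₂) * σ ^ #H)) / η ^ 2 *
          ∏ s ∈ S, (s : ℝ) := by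
          congr 1
          have hσr' : σ ^ #H ≠ 0 := hσr.ne'
          have hη' : η ≠ 0 := hη.ne'
          have h1δ₂' : 1 - δ₂ ≠ 0 := h1δ₂.ne'
          rw [show σ ^ (2 * #H) = σ ^ #H * σ ^ #H by rw [two_mul, pow_add]]
          field_simp

/-- **Lemma 6.3 per prime, for `𝒫(a⃗)`**: for `p ∈ 𝒫` with weight `w(p, ·) ≥ 0` supported in `N`,
`w(p, ·) ≤ W`, `Σ_n w(p, n) ≥ T > 0` (so `P(ñ_p = n) ≤ W/T`), the number of `a⃗` in the box of
`𝒮 = primesS x` with `p ∉ 𝒫(a⃗)` (i.e. `|X_p(a⃗) − σ^r| > η σ^r`, `goodPrimes` with `X₀ = σ^r`) obeys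
the bound of `lemma63_count` with `Λ = W/T`.
[cite: FordGreenKonyaginMaynardTao2018, Lemma 6.3 p. 18] -/
theorem card_box_not_goodPrimes_le {x : ℕ} (hS : ∀ s ∈ primesS x, s.Prime) {s₀ : ℕ}
    (hs₀ : 2 ≤ s₀) (hSs₀ : ∀ s ∈ primesS x, s₀ ≤ s) {H : Finset ℤ} {p : ℕ}
    (hp : p ∈ primesHalf x) {w : ℕ → ℤ → ℝ} (hw : ∀ p n, 0 ≤ w p n) {N : Finset ℤ} {W T : ℝ}
    (hW0 : 0 ≤ W) (hW : ∀ n, w p n ≤ W) (hT : T ≤ ∑ m ∈ N, w p m) (hT0 : 0 < T) {M : ℝ}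
    (hM1 : 1 ≤ M)
    (hM : ∀ n ∈ N, ∀ n' ∈ N, ∀ h ∈ H, ∀ h' ∈ H,
      |((n + h * (p : ℤ) : ℤ) : ℝ) - ((n' + h' * (p : ℤ) : ℤ) : ℝ)| ≤ M)
    (h2r : 2 * #H ≤ s₀)
    (hδ₂ : (2 * (#H : ℝ)) ^ 3 * Real.log M / (s₀ * Real.log s₀) < 1) {η : ℝ} (hη : 0 < η) :
    (#((residueBox (primesS x)).filter fun f =>
        p ∉ goodPrimes x (extendRes (primesS x) f) H w N (sigmaProd (primesS x) ^ #H) η) : ℝ) ≤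
      ((1 / (1 - (2 * (#H : ℝ)) ^ 3 * Real.log M / (s₀ * Real.log s₀)) -
            2 * Real.exp (-(2 * (#H : ℝ) ^ 2 * ∑ s ∈ primesS x, 1 / (s : ℝ) ^ 2)) + 1) +
          (#H : ℝ) ^ 2 * (W / T) /
            ((1 - (2 * (#H : ℝ)) ^ 3 * Real.log M / (s₀ * Real.log s₀)) *
              sigmaProd (primesS x) ^ #H)) /
        η ^ 2 * ∏ s ∈ primesS x, (s : ℝ) := by
  classical
  have hp0 : p ≠ 0 := (pos_of_mem_primesHalf hp).ne'
  have hsumw : ∑ m ∈ N, w p m ≠ 0 := (lt_of_lt_of_le hT0 hT).ne'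
  have hlam : ∀ n, 0 ≤ lawTilde w N p n := fun n => lawTilde_nonneg hw N p n
  have hΛ : ∀ n, lawTilde w N p n ≤ W / T := fun n => lawTilde_le hW0 (hW n) hT hT0
  have hsum : ∑ n ∈ N, lawTilde w N p n = 1 := sum_lawTilde N p hsumw
  refine le_trans ?_ (lemma63_count hS hs₀ hSs₀ hp0 hlam hΛ hsum hM1 hM h2r hδ₂ hη)
  refine Nat.cast_le.2 (Finset.card_le_card fun f hf => ?_)
  rw [Finset.mem_filter] at hf ⊢
  refine ⟨hf.1, ?_⟩
  have hnot := hf.2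
  rw [mem_goodPrimes, not_and] at hnot
  have h := hnot hp
  rw [not_le, Xp_extendRes_eq] at h
  exact h.le

end FGKMT2018

end Literature.NumberTheory.Sieve
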